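import Mathlib
import HarnessLib
import Summits.Ventures.LatticeQCDFlow.Scaling.AcceptanceVolumeSandwichIntegral
import Summits.Ventures.LatticeQCDFlow.Scaling.AcceptanceVolumeFloorRigidity

/-!
# LatticeQCDFlow / Scaling — rigidity of the acceptance volume floor on a GENERAL space, I:
# oriented pairs of graded weights have positive measure; `acc(⊗) − acc·acc′ = ∫ (K − L) dM`

HONEST FRAMING: exact (Metropolis-corrected) sampling algorithms for lattice gauge theory;
figures of merit are autocorrelation/cost numbers at stated couplings and volumes; no
continuum-physics claim.

Venture `LatticeQCDFlow` (cell pub-lqcd), topic `Scaling`; FANOUT row 3 (`s0-u1-a`, S0-B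
implementation A, GEN-13).  NEW WORK of the cell (elementary measure theory), the general-space form
of row 3's finite `Scaling/AcceptanceVolumeFloorRigidity` (imported for the pointwise equality /
strictness lemmas `min_mul_min_eq_of_*`, `min_mul_min_lt_min_mul`) in the setting of row 3's
`Scaling/AcceptanceVolumeSandwichIntegral` (imported: s-finite reference measures `μ` on `X`, `μ′` on
`Y`, targets `p, p′ ≥ 0` with `∫ = 1`, models `q, q′ > 0`; `acc(p, q) = ∫∫ min(p(a)q(b), p(b)q(a))`;
the floor `acc·acc′ ≤ acc(⊗)` and the re-pairing `measurePreserving_rePair`).  NO definition is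
introduced; "hit-or-miss a.e." is spelled `∃ c, ∀ᵐ x ∂μ, 0 < p x → p x / q x = c` as in row 3's
`Scoring/AllPairsAcceptanceVarianceRigidity`.

* §1 one block: **`hitOrMiss_ae_of_measure_crossLt_eq_zero`** — if the ORIENTED pair set
  `{(a,b) : 0 < p(a)q(b) < p(b)q(a)}` is `μ⊗μ`-null then the pair is hit-or-miss a.e. (swap symmetry
  of `μ⊗μ`, `Measure.ae_ae_of_ae_prod`, a point of positive target mass); hence a block that is not
  hit-or-miss a.e. charges both oriented pair sets (`measure_crossLt_pos`, `measure_crossGt_pos`);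
* §2 two blocks on `M = (μ⊗μ′)⊗(μ⊗μ′)`: the acceptance kernel `K` of the product pair and the product
  `L` of the block kernels are integrable, `∫ K dM = acc(⊗)` and `∫ L dM = acc·acc′` (re-pairing +
  Fubini), so **`meanAccept_prod_sub_mul_eq_integral`** `acc(⊗) − acc·acc′ = ∫ (K − L) dM`, `K ≥ L`;
* the equality / strictness statements themselves (`K = L` a.e. for a hit-or-miss block; `K > L`
  on a re-paired rectangle of positive `M`-measure when both blocks are graded; the equality case
  `acc·acc′ = acc(⊗) ↔` one block hit-or-miss a.e.) are the companion file
  `Scaling/AcceptanceVolumeFloorRigidityIntegralEq`.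

Reading (value-free): on any pair of configuration spaces, gluing two independently proposed blocks
yields exactly the product of the block acceptances only when one block is an all-or-nothing proposal;
two blocks with genuinely graded importance weights accept strictly more often than the product.
NOT CLAIMED: the `m`-block general-space form; a quantitative excess; coupled flows; any number of ours.
-/

namespace Summit.Ventures.LatticeQCDFlow.Theory2

open MeasureTheory Set

/-! ## §1 One block: oriented pairs of graded weights have positive measure -/

section OneBlock

variable {X : Type*} [MeasurableSpace X] {μ : Measure X} [SFinite μ]

omit [SFinite μ] in
/-- The oriented pair set `{(a,b) : 0 < p(a)q(b) < p(b)q(a)}` is measurable. [folklore] -/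
theorem measurableSet_crossLt {p q : X → ℝ} (hpm : Measurable p) (hqm : Measurable q) :
    MeasurableSet {z : X × X | 0 < p z.1 * q z.2 ∧ p z.1 * q z.2 < p z.2 * q z.1} := by
  have hf : Measurable fun z : X × X => p z.1 * q z.2 :=
    (hpm.comp measurable_fst).mul (hqm.comp measurable_snd)
  have hg : Measurable fun z : X × X => p z.2 * q z.1 :=
    (hpm.comp measurable_snd).mul (hqm.comp measurable_fst)
  exact (measurableSet_lt measurable_const hf).inter (measurableSet_lt hf hg)

/-- The reversed oriented pair set has the same `μ⊗μ`-measure (swap symmetry). [folklore] -/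
theorem measure_crossGt_eq_measure_crossLt {p q : X → ℝ} (hpm : Measurable p) (hqm : Measurable q) :
    (μ.prod μ) {z : X × X | 0 < p z.2 * q z.1 ∧ p z.2 * q z.1 < p z.1 * q z.2}
      = (μ.prod μ) {z : X × X | 0 < p z.1 * q z.2 ∧ p z.1 * q z.2 < p z.2 * q z.1} := by
  have h := (Measure.measurePreserving_swap (μ := μ) (ν := μ)).measure_preimage
    (measurableSet_crossLt hpm hqm).nullMeasurableSet
  rw [← h]
  rfl

/-- **A `μ⊗μ`-NULL ORIENTED PAIR SET FORCES HIT-OR-MISS a.e.**: for a normalised target `p ≥ 0` and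
a model `q > 0`, if `{(a,b) : 0 < p(a)q(b) < p(b)q(a)}` is `μ⊗μ`-null then all positive importance
ratios agree almost everywhere. [ours] -/
theorem hitOrMiss_ae_of_measure_crossLt_eq_zero {p q : X → ℝ} (hp0 : ∀ x, 0 ≤ p x)
    (hpm : Measurable p) (hp1 : ∫ x, p x ∂μ = 1) (hq0 : ∀ x, 0 < q x) (hqm : Measurable q)
    (h : (μ.prod μ) {z : X × X | 0 < p z.1 * q z.2 ∧ p z.1 * q z.2 < p z.2 * q z.1} = 0) :
    ∃ c : ℝ, ∀ᵐ x ∂μ, 0 < p x → p x / q x = c := by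
  have h' : (μ.prod μ) {z : X × X | 0 < p z.2 * q z.1 ∧ p z.2 * q z.1 < p z.1 * q z.2} = 0 := by
    rw [measure_crossGt_eq_measure_crossLt hpm hqm, h]
  have hae : ∀ᵐ z ∂(μ.prod μ), ¬ (0 < p z.1 * q z.2 ∧ p z.1 * q z.2 < p z.2 * q z.1) ∧
      ¬ (0 < p z.2 * q z.1 ∧ p z.2 * q z.1 < p z.1 * q z.2) :=
    (measure_eq_zero_iff_ae_notMem.1 h).and (measure_eq_zero_iff_ae_notMem.1 h')
  have hxy : ∀ᵐ a ∂μ, ∀ᵐ b ∂μ, ¬ (0 < p a * q b ∧ p a * q b < p b * q a) ∧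
      ¬ (0 < p b * q a ∧ p b * q a < p a * q b) :=
    Measure.ae_ae_of_ae_prod hae
  -- a point of the full-measure set carrying positive target mass
  obtain ⟨a₀, ha₀p, ha₀⟩ : ∃ a₀, 0 < p a₀ ∧ ∀ᵐ b ∂μ, ¬ (0 < p a₀ * q b ∧ p a₀ * q b < p b * q a₀) ∧
      ¬ (0 < p b * q a₀ ∧ p b * q a₀ < p a₀ * q b) := by
    by_contra hne
    have hp0ae : p =ᵐ[μ] 0 := by
      refine hxy.mono fun a ha => ?_
      have : ¬ 0 < p a := fun hpa => hne ⟨a, hpa, ha⟩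
      exact le_antisymm (not_lt.mp this) (hp0 a)
    have : ∫ x, p x ∂μ = 0 := by rw [integral_congr_ae hp0ae]; simp
    rw [hp1] at this
    exact one_ne_zero this
  refine ⟨p a₀ / q a₀, ha₀.mono fun b hb hpb => ?_⟩
  obtain ⟨h1, h2⟩ := hb
  have hab : 0 < p a₀ * q b := mul_pos ha₀p (hq0 b)
  have hba : 0 < p b * q a₀ := mul_pos hpb (hq0 a₀)
  have e1 : p b * q a₀ ≤ p a₀ * q b := not_lt.1 fun hlt => h1 ⟨hab, hlt⟩
  have e2 : p a₀ * q b ≤ p b * q a₀ := not_lt.1 fun hlt => h2 ⟨hba, hlt⟩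
  rw [div_eq_div_iff (hq0 b).ne' (hq0 a₀).ne']
  linarith

/-- **A block that is NOT hit-or-miss a.e. charges the oriented pair set.** [ours] -/
theorem measure_crossLt_pos {p q : X → ℝ} (hp0 : ∀ x, 0 ≤ p x) (hpm : Measurable p)
    (hp1 : ∫ x, p x ∂μ = 1) (hq0 : ∀ x, 0 < q x) (hqm : Measurable q)
    (h : ¬ ∃ c : ℝ, ∀ᵐ x ∂μ, 0 < p x → p x / q x = c) :
    0 < (μ.prod μ) {z : X × X | 0 < p z.1 * q z.2 ∧ p z.1 * q z.2 < p z.2 * q z.1} :=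
  pos_iff_ne_zero.2 fun h0 => h (hitOrMiss_ae_of_measure_crossLt_eq_zero hp0 hpm hp1 hq0 hqm h0)

/-- … and the reversed oriented pair set as well. [ours] -/
theorem measure_crossGt_pos {p q : X → ℝ} (hp0 : ∀ x, 0 ≤ p x) (hpm : Measurable p)
    (hp1 : ∫ x, p x ∂μ = 1) (hq0 : ∀ x, 0 < q x) (hqm : Measurable q)
    (h : ¬ ∃ c : ℝ, ∀ᵐ x ∂μ, 0 < p x → p x / q x = c) :
    0 < (μ.prod μ) {z : X × X | 0 < p z.2 * q z.1 ∧ p z.2 * q z.1 < p z.1 * q z.2} := by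
  rw [measure_crossGt_eq_measure_crossLt hpm hqm]
  exact measure_crossLt_pos hp0 hpm hp1 hq0 hqm h

end OneBlock

/-! ## §2 Two blocks: the acceptance kernel and the product of the block kernels on `(μ⊗μ′)⊗(μ⊗μ′)` -/

section TwoBlocks

variable {X Y : Type*} [MeasurableSpace X] [MeasurableSpace Y] {μ : Measure X} {μ' : Measure Y}
  [SFinite μ] [SFinite μ'] {p q : X → ℝ} {p' q' : Y → ℝ}

omit [SFinite μ] [SFinite μ'] in
/-- Measurability of the product-pair acceptance kernel `K`. [folklore] -/
theorem measurable_prodKernel (hpm : Measurable p) (hqm : Measurable q) (hpm' : Measurable p')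
    (hqm' : Measurable q') :
    Measurable fun e : (X × Y) × (X × Y) =>
      min (p e.1.1 * p' e.1.2 * (q e.2.1 * q' e.2.2)) (p e.2.1 * p' e.2.2 * (q e.1.1 * q' e.1.2)) := by
  have h11 : Measurable fun e : (X × Y) × (X × Y) => e.1.1 := measurable_fst.comp measurable_fst
  have h12 : Measurable fun e : (X × Y) × (X × Y) => e.1.2 := measurable_snd.comp measurable_fst
  have h21 : Measurable fun e : (X × Y) × (X × Y) => e.2.1 := measurable_fst.comp measurable_snd
  have h22 : Measurable fun e : (X × Y) × (X × Y) => e.2.2 := measurable_snd.comp measurable_snd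
  exact (((hpm.comp h11).mul (hpm'.comp h12)).mul ((hqm.comp h21).mul (hqm'.comp h22))).min
    (((hpm.comp h21).mul (hpm'.comp h22)).mul ((hqm.comp h11).mul (hqm'.comp h12)))

omit [SFinite μ] [SFinite μ'] in
/-- Measurability of the product `L` of the two block kernels. [folklore] -/
theorem measurable_blockKernelProd (hpm : Measurable p) (hqm : Measurable q) (hpm' : Measurable p')
    (hqm' : Measurable q') :
    Measurable fun e : (X × Y) × (X × Y) =>
      min (p e.1.1 * q e.2.1) (p e.2.1 * q e.1.1) * min (p' e.1.2 * q' e.2.2) (p' e.2.2 * q' e.1.2) := by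
  have h11 : Measurable fun e : (X × Y) × (X × Y) => e.1.1 := measurable_fst.comp measurable_fst
  have h12 : Measurable fun e : (X × Y) × (X × Y) => e.1.2 := measurable_snd.comp measurable_fst
  have h21 : Measurable fun e : (X × Y) × (X × Y) => e.2.1 := measurable_fst.comp measurable_snd
  have h22 : Measurable fun e : (X × Y) × (X × Y) => e.2.2 := measurable_snd.comp measurable_snd
  exact (((hpm.comp h11).mul (hqm.comp h21)).min ((hpm.comp h21).mul (hqm.comp h11))).mul
    (((hpm'.comp h12).mul (hqm'.comp h22)).min ((hpm'.comp h22).mul (hqm'.comp h12)))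

omit [SFinite μ] [SFinite μ'] in
/-- The dominating function `p(a)p′(c)·q(b)q′(d)` is integrable on `(μ⊗μ′)⊗(μ⊗μ′)`. [folklore] -/
theorem integrable_prodDominant (hpi : Integrable p μ) (hqi : Integrable q μ)
    (hpi' : Integrable p' μ') (hqi' : Integrable q' μ') :
    Integrable (fun e : (X × Y) × (X × Y) => p e.1.1 * p' e.1.2 * (q e.2.1 * q' e.2.2))
      ((μ.prod μ').prod (μ.prod μ')) :=
  (hpi.mul_prod hpi').mul_prod (hqi.mul_prod hqi')

omit [SFinite μ] [SFinite μ'] in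
/-- `K` is integrable (dominated by `p(a)p′(c)q(b)q′(d)`). [ours] -/
theorem integrable_prodKernel (hp0 : ∀ x, 0 ≤ p x) (hpm : Measurable p) (hpi : Integrable p μ)
    (hq0 : ∀ x, 0 < q x) (hqm : Measurable q) (hqi : Integrable q μ) (hp0' : ∀ y, 0 ≤ p' y)
    (hpm' : Measurable p') (hpi' : Integrable p' μ') (hq0' : ∀ y, 0 < q' y) (hqm' : Measurable q')
    (hqi' : Integrable q' μ') :
    Integrable (fun e : (X × Y) × (X × Y) =>
      min (p e.1.1 * p' e.1.2 * (q e.2.1 * q' e.2.2)) (p e.2.1 * p' e.2.2 * (q e.1.1 * q' e.1.2)))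
      ((μ.prod μ').prod (μ.prod μ')) := by
  refine (integrable_prodDominant hpi hqi hpi' hqi').mono'
    (measurable_prodKernel hpm hqm hpm' hqm').aestronglyMeasurable
    (Filter.Eventually.of_forall fun e => ?_)
  have h1 : 0 ≤ p e.1.1 * p' e.1.2 * (q e.2.1 * q' e.2.2) :=
    mul_nonneg (mul_nonneg (hp0 _) (hp0' _)) (mul_nonneg (hq0 _).le (hq0' _).le)
  have h2 : 0 ≤ p e.2.1 * p' e.2.2 * (q e.1.1 * q' e.1.2) :=
    mul_nonneg (mul_nonneg (hp0 _) (hp0' _)) (mul_nonneg (hq0 _).le (hq0' _).le)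
  rw [Real.norm_of_nonneg (le_min h1 h2)]
  exact min_le_left _ _

omit [SFinite μ] [SFinite μ'] in
/-- `L` is integrable (dominated by the same function). [ours] -/
theorem integrable_blockKernelProd (hp0 : ∀ x, 0 ≤ p x) (hpm : Measurable p)
    (hpi : Integrable p μ) (hq0 : ∀ x, 0 < q x) (hqm : Measurable q) (hqi : Integrable q μ)
    (hp0' : ∀ y, 0 ≤ p' y) (hpm' : Measurable p') (hpi' : Integrable p' μ') (hq0' : ∀ y, 0 < q' y)
    (hqm' : Measurable q') (hqi' : Integrable q' μ') :
    Integrable (fun e : (X × Y) × (X × Y) =>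
      min (p e.1.1 * q e.2.1) (p e.2.1 * q e.1.1) * min (p' e.1.2 * q' e.2.2) (p' e.2.2 * q' e.1.2))
      ((μ.prod μ').prod (μ.prod μ')) := by
  refine (integrable_prodDominant hpi hqi hpi' hqi').mono'
    (measurable_blockKernelProd hpm hqm hpm' hqm').aestronglyMeasurable
    (Filter.Eventually.of_forall fun e => ?_)
  have ha : 0 ≤ p e.1.1 * q e.2.1 := mul_nonneg (hp0 _) (hq0 _).le
  have ha' : 0 ≤ p e.2.1 * q e.1.1 := mul_nonneg (hp0 _) (hq0 _).le
  have hb : 0 ≤ p' e.1.2 * q' e.2.2 := mul_nonneg (hp0' _) (hq0' _).le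
  have hb' : 0 ≤ p' e.2.2 * q' e.1.2 := mul_nonneg (hp0' _) (hq0' _).le
  rw [Real.norm_of_nonneg (mul_nonneg (le_min ha ha') (le_min hb hb'))]
  calc min (p e.1.1 * q e.2.1) (p e.2.1 * q e.1.1) * min (p' e.1.2 * q' e.2.2) (p' e.2.2 * q' e.1.2)
      ≤ (p e.1.1 * q e.2.1) * (p' e.1.2 * q' e.2.2) :=
        mul_le_mul (min_le_left _ _) (min_le_left _ _) (le_min hb hb') ha
    _ = p e.1.1 * p' e.1.2 * (q e.2.1 * q' e.2.2) := by ring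

omit [SFinite μ] in
/-- The block kernel `min(p(a)q(b), p(b)q(a))` is integrable on `μ⊗μ`. [folklore] -/
theorem integrable_blockKernel (hp0 : ∀ x, 0 ≤ p x) (hpm : Measurable p) (hpi : Integrable p μ)
    (hq0 : ∀ x, 0 < q x) (hqm : Measurable q) (hqi : Integrable q μ) :
    Integrable (fun z : X × X => min (p z.1 * q z.2) (p z.2 * q z.1)) (μ.prod μ) := by
  refine (hpi.mul_prod hqi).mono'
    (((hpm.comp measurable_fst).mul (hqm.comp measurable_snd)).min
      ((hpm.comp measurable_snd).mul (hqm.comp measurable_fst))).aestronglyMeasurable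
    (Filter.Eventually.of_forall fun z => ?_)
  rw [Real.norm_of_nonneg (le_min (mul_nonneg (hp0 _) (hq0 _).le) (mul_nonneg (hp0 _) (hq0 _).le))]
  exact min_le_left _ _

/-- **`∫ L dM = acc(p,q)·acc(p′,q′)`** (re-pairing + Fubini). [ours] -/
theorem integral_blockKernelProd (hp0 : ∀ x, 0 ≤ p x) (hpm : Measurable p) (hpi : Integrable p μ)
    (hq0 : ∀ x, 0 < q x) (hqm : Measurable q) (hqi : Integrable q μ) (hp0' : ∀ y, 0 ≤ p' y)
    (hpm' : Measurable p') (hpi' : Integrable p' μ') (hq0' : ∀ y, 0 < q' y) (hqm' : Measurable q')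
    (hqi' : Integrable q' μ') :
    ∫ e, min (p e.1.1 * q e.2.1) (p e.2.1 * q e.1.1) * min (p' e.1.2 * q' e.2.2) (p' e.2.2 * q' e.1.2)
        ∂((μ.prod μ').prod (μ.prod μ'))
      = (∫ a, ∫ b, min (p a * q b) (p b * q a) ∂μ ∂μ)
          * ∫ c, ∫ d, min (p' c * q' d) (p' d * q' c) ∂μ' ∂μ' := by
  have hT := measurePreserving_rePair μ μ'
  have hFm : Measurable fun u : (X × X) × (Y × Y) =>
      min (p u.1.1 * q u.1.2) (p u.1.2 * q u.1.1) * min (p' u.2.1 * q' u.2.2) (p' u.2.2 * q' u.2.1) := by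
    have h11 : Measurable fun u : (X × X) × (Y × Y) => u.1.1 := measurable_fst.comp measurable_fst
    have h12 : Measurable fun u : (X × X) × (Y × Y) => u.1.2 := measurable_snd.comp measurable_fst
    have h21 : Measurable fun u : (X × X) × (Y × Y) => u.2.1 := measurable_fst.comp measurable_snd
    have h22 : Measurable fun u : (X × X) × (Y × Y) => u.2.2 := measurable_snd.comp measurable_snd
    exact (((hpm.comp h11).mul (hqm.comp h12)).min ((hpm.comp h12).mul (hqm.comp h11))).mul
      (((hpm'.comp h21).mul (hqm'.comp h22)).min ((hpm'.comp h22).mul (hqm'.comp h21)))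
  have htrans : ∫ e, min (p e.1.1 * q e.2.1) (p e.2.1 * q e.1.1)
      * min (p' e.1.2 * q' e.2.2) (p' e.2.2 * q' e.1.2) ∂((μ.prod μ').prod (μ.prod μ'))
      = ∫ u, min (p u.1.1 * q u.1.2) (p u.1.2 * q u.1.1) * min (p' u.2.1 * q' u.2.2) (p' u.2.2 * q' u.2.1)
          ∂((μ.prod μ).prod (μ'.prod μ')) := by
    rw [← hT.map_eq, integral_map hT.measurable.aemeasurable hFm.aestronglyMeasurable]
  rw [htrans, integral_prod_mul (μ := μ.prod μ) (ν := μ'.prod μ')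
      (fun ab : X × X => min (p ab.1 * q ab.2) (p ab.2 * q ab.1))
      (fun cd : Y × Y => min (p' cd.1 * q' cd.2) (p' cd.2 * q' cd.1)),
    integral_prod _ (integrable_blockKernel hp0 hpm hpi hq0 hqm hqi),
    integral_prod _ (integrable_blockKernel hp0' hpm' hpi' hq0' hqm' hqi')]

/-- **THE DEFECT OF THE FLOOR AS AN INTEGRAL**: `acc(p⊗p′, q⊗q′) − acc(p,q)·acc(p′,q′) = ∫ (K − L) dM`
with `K ≥ L` pointwise. [ours] -/
theorem meanAccept_prod_sub_mul_eq_integral (hp0 : ∀ x, 0 ≤ p x) (hpm : Measurable p)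
    (hpi : Integrable p μ) (hq0 : ∀ x, 0 < q x) (hqm : Measurable q) (hqi : Integrable q μ)
    (hp0' : ∀ y, 0 ≤ p' y) (hpm' : Measurable p') (hpi' : Integrable p' μ') (hq0' : ∀ y, 0 < q' y)
    (hqm' : Measurable q') (hqi' : Integrable q' μ') :
    (∫ z, ∫ z', min (p z.1 * p' z.2 * (q z'.1 * q' z'.2)) (p z'.1 * p' z'.2 * (q z.1 * q' z.2))
        ∂(μ.prod μ') ∂(μ.prod μ'))
      - (∫ a, ∫ b, min (p a * q b) (p b * q a) ∂μ ∂μ) * (∫ c, ∫ d, min (p' c * q' d) (p' d * q' c) ∂μ' ∂μ')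
      = ∫ e, (min (p e.1.1 * p' e.1.2 * (q e.2.1 * q' e.2.2)) (p e.2.1 * p' e.2.2 * (q e.1.1 * q' e.1.2))
          - min (p e.1.1 * q e.2.1) (p e.2.1 * q e.1.1) * min (p' e.1.2 * q' e.2.2) (p' e.2.2 * q' e.1.2))
          ∂((μ.prod μ').prod (μ.prod μ')) := by
  rw [integral_sub (integrable_prodKernel hp0 hpm hpi hq0 hqm hqi hp0' hpm' hpi' hq0' hqm' hqi')
      (integrable_blockKernelProd hp0 hpm hpi hq0 hqm hqi hp0' hpm' hpi' hq0' hqm' hqi'),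
    integral_prod _ (integrable_prodKernel hp0 hpm hpi hq0 hqm hqi hp0' hpm' hpi' hq0' hqm' hqi'),
    integral_blockKernelProd hp0 hpm hpi hq0 hqm hqi hp0' hpm' hpi' hq0' hqm' hqi']

omit [MeasurableSpace X] [MeasurableSpace Y] [SFinite μ] [SFinite μ'] in
/-- Pointwise `L ≤ K` in the kernel's arrangement. [folklore] -/
theorem blockKernelProd_le_prodKernel (hp0 : ∀ x, 0 ≤ p x) (hq0 : ∀ x, 0 < q x)
    (hp0' : ∀ y, 0 ≤ p' y) (hq0' : ∀ y, 0 < q' y) (e : (X × Y) × (X × Y)) :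
    min (p e.1.1 * q e.2.1) (p e.2.1 * q e.1.1) * min (p' e.1.2 * q' e.2.2) (p' e.2.2 * q' e.1.2)
      ≤ min (p e.1.1 * p' e.1.2 * (q e.2.1 * q' e.2.2)) (p e.2.1 * p' e.2.2 * (q e.1.1 * q' e.1.2)) := by
  have h := min_mul_min_le_min_mul (mul_nonneg (hp0 e.1.1) (hq0 e.2.1).le)
    (mul_nonneg (hp0 e.2.1) (hq0 e.1.1).le) (mul_nonneg (hp0' e.1.2) (hq0' e.2.2).le)
    (mul_nonneg (hp0' e.2.2) (hq0' e.1.2).le)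
  calc _ ≤ min (p e.1.1 * q e.2.1 * (p' e.1.2 * q' e.2.2)) (p e.2.1 * q e.1.1 * (p' e.2.2 * q' e.1.2)) := h
    _ = _ := by congr 1 <;> ring

end TwoBlocks

end Summit.Ventures.LatticeQCDFlow.Theory2
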